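import Summits.QuantumFields.BalabanUV.T4Continuum.Spine.NE3.FlatLandauGaugeStep
import Summits.QuantumFields.BalabanUV.T4Continuum.Spine.NE3.LandauCorrectionSupB8Flat
import Summits.QuantumFields.BalabanUV.T4Continuum.Support.NE3ResidualSliceRep
import Summits.QuantumFields.BalabanUV.T4Continuum.Support.AveragingDeficitKDatum
import HarnessLib

/-!
# T⁴ programme, node NE3 — [B8] AT THE FLAT BACKGROUND, brick E, letter 3: ONE NEWTON STEP OF THE FLAT LANDAU SCHEME —
# the Landau defect contracts, `‖Δ_1λ′‖ ≤ c_R·Θ·‖Δ_1λ‖` with `Θ = 4c₀M²(b + D) + 25·d·r·c₁M + 14·d·c₁²M²D` (`FlatLandauNewtonStep`)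

Cell `pub-balaban`, rung (B)+1 sub-cell t4, row NE3 (OWNER lineage `b2b-balaban-t4-ne3-p1`, generation 27; technique of record:
implicit-function ∕ contraction mapping).  Third file of the chain «BRICK E OF REP♭ AT FLAT PAIRS» (the EXACT nonlinear (1.38)-Landau step
of [Balaban1985RegularSpaces] Sect. E, Prop. 5 pp. 89–94 — the fixed point (1.100) `λ = G′R∂*A + G′Rg₄(λ, ∂λ, A, ∂*A)` — AT THE FLAT
BACKGROUND on the T⁴ programme's lattice; asked of «row NE3's owner» by the CRUX prover NE7: HOME/INBOX [NE7P1-G72-INBOX-4], crux card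
`t4/b2b-balaban-t4-ne7-p1-g72/REP-FLAT-CRUX-CARD.md` N3, road `t4/b2b-balaban-t4-ne7-p1-g73/REP-FLAT-ROAD-v2.md` §4 brick E), over letters
1 `FlatLandauExpStar`, 2a `FlatLandauGaugeBond`, 2b `FlatLandauGaugeStep` and row NE3's flat Landau letters (`LandauProjectionB8`,
`LandauCorrectionSupB8Flat[H0]`, `LandauProjectionSupFlat`).

THE SCHEME (here: ONE step, all data explicit; letter 4 iterates).  Torus period `P = N·L^{j+1}`, block `M = L^{j+1}`, flat background.
STATE: a unitary periodic gauge `u`; the field `V := U^{u}` with `‖V(b) − 1‖ ≤ r` and `‖covDiv 1 (log V)‖_∞ ≤ b`; its LINEAR LANDAU CORRECTION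
`λ ∈ N(Q′(1))` (`LandauProjectionB8.exists_landauB8_correction`: `log V + D_1λ` is (1.38)-Landau) with `‖Δ_1λ‖_∞ ≤ D`.  STEP: `u′ := e^{λ}·u`,
`V′ = U^{u′} = V^{e^λ}`, and `λ′` := the linear Landau correction of `log V′`.  With the flat sup letters (H0) `‖λ‖ ≤ c₀M²D`, `‖∇λ‖ ≤ c₁MD`
(`LandauCorrectionSupB8FlatH0.supRegularity_flatCfg`: `c₀ = 16d³`, `c₁ = 16d²`) and (HR) `‖Δ_1μ‖_∞ ≤ c_R‖F‖_∞` for `F + Δ_1μ ⊥ Δ_1N(Q′(1))`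
(`LandauProjectionSupFlat.covLapSite_sup_le_flatCfg`) — taken here as DISPLAYED HYPOTHESES `hG`, `hR` with constants `c₀, c₁, c_R`, in the
binder shape of `LandauCorrectionSupB8Flat.landauCorrectionSupB8_flatCfg_of_supFacts`, so that an `N`-uniform (HR) can be plugged unchanged —
the conclusions are: `u′` unitary periodic; `‖V′(b) − 1‖ ≤ r + (5∕4)c₁MD`; `‖covDiv 1 log V′‖_∞ ≤ b + D + D·Θ`; **`‖Δ_1λ′‖_∞ ≤ c_R·D·Θ`**;
`‖u′ − u‖ ≤ 2c₀M²D`; where `Θ := 4c₀M²(b + D) + 25·d·r·c₁M + 14·d·(c₁M)²D`.  Under the regime `c₀M²D ≤ 1∕10`, `c₁MD ≤ 1∕25`, `r ≤ 1∕20`.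
KEY POINT: `J := covDiv 1 log V′ − covDiv 1 log V − Δ_1λ` is orthogonal-compatible — `(covDiv 1 log V′ + Δ_1λ′) − (covDiv 1 log V + Δ_1λ) = J + Δ_1λ′`
and both brackets are `⊥ Δ_1N(Q′(1))` (`LandauCorrectionSupB8Flat.sum_hsR_covDiv_add_covLapSite_eq_zero_of_isLandauB8`) — so (HR) bounds the NEXT
defect by `c_R‖J‖_∞`, and letter 2b bounds `‖J‖_∞ ≤ D·Θ`: a contraction as soon as `c_R·Θ ≤ 1∕2`, uniformly in `M` iff `M·r`, `M²·b`, `M²·D` are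
bounded (the (−1)∕(−2)-size currencies of [Balaban1985RegularSpaces] (1.36)).

WHAT ([folklore]; `d ≥ 1`, `n : Type*` nonempty finite, `L ≥ 2`, `N ≥ 1`; 0 def, 0 sorry):
* §1 letters: (`NE3ResidualSliceRep.isPeriodicCfg_gaugeAct`, `AveragingDeficitKDatum.isUnitaryCfg_gaugeAct` cited), `isPeriodicDir_mlog_cfg`, `isSkewDir_mlog_cfg`, `covLapSite_flatCfg_skew`.
* §2 **`newton_step`** — the displayed one-step statement.

HONEST FRAMING (page 1): elementary lattice analysis of OUR objects at the FLAT background; the (H0)∕(HR) letters are hypotheses BY SHAPE (both PROVED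
at the flat datum in the tree, the latter with a constant polynomial in `N`); nothing of Bałaban's is used, asserted or discharged; brick E is NOT
landed by this file (letter 4 iterates and passes to the limit); REP♭ NOT proved; NE3 ∕ NE7 NOT proved; spine PROVED 0∕9; finite T⁴ rung (B)+1 —
NOT infinite volume, NOT mass gap, NOT `BetaPertH`, NOT Clay.  Continuum YM on T⁴ ⇐ BetaPertH ∧ nine spine estimates (0/9 proved); BetaPertH ⇐
(D1) ∧ (D4) ∧ CAP+tail; G-an2-4 gates asym, D1 and NE2/3/4.  PLACEMENT: our lemma, `Spine/NE3/`.
-/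

set_option autoImplicit false

open NormedSpace
open scoped BigOperators Matrix.Norms.L2Operator
open Finset

namespace Summit.QuantumFields.BalabanUV.T4Continuum.NE3.FlatLandauNewtonStep

open Literature.MathematicalPhysics.QuantumFieldTheory.Balaban1983to89
open B7Prop1Explicit B7Prop2Explicit MatrixLog
open T4AveragingDeficitWall (Ad IsUnitaryCfg IsSkewDir)
open T4AveragingDeficitWallBoundary (IsPeriodicCfg periodBox)
open AveragingDeficitPeriodicCounting (IsPeriodicDir)
open AveragingDeficitTransport (norm_Ad_of_unitary mem_U1_of_unitary)
open MinimalActionWitness (flatCfg isPeriodicCfg_flatCfg)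
open NE3FlatHessianCurl (isUnitaryCfg_flatCfg)
open NE3EnergyShapes (IsUnitarySite IsPeriodicSite)
open NE3CovariantWeitzenbock (covDiv covDiv_flatCfg)
open NE3CurvedCornerGaugeSpace (covDiv_mem_skewAdjoint)
open NE3LandauOrbit (covDiv_add_period gaugeDir_skew)
open NE3CovariantCalculus (hsR hsR_sub_left)
open BlockAveragePushDirGauge (gaugeDir isPeriodicDir_gaugeDir)
open NE3FrameFreeSliceUnique (gaugeDir_flatCfg_eq_neg_dPot)
open NE3TangentNoGoWords (dPot)
open NE3.PairLandauB8 (avgKernelGauges IsLandauB8 covLapSite)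
open NE3.LandauProjectionB8 (covDiv_gaugeDir_eq_covLapSite covLapSite_add_period)
open NE3.LandauCorrectionSupB8Flat (sum_hsR_covDiv_add_covLapSite_eq_zero_of_isLandauB8)
open NE3.FlatLandauGaugeBond (expGauge_unitary norm_expGauge_sub_one_le mlog_mem_skewAdjoint_of_unitary)
open NE3.FlatLandauGaugeStep (norm_covDiv_mlog_gaugeAct_sub_le gaugeAct_letters)

noncomputable section

variable {d : ℕ} {n : Type*} [Fintype n] [DecidableEq n]

/-! ## §1 Letters: periodicity, unitarity and skewness of the gauged field and its logarithm -/

/-- The bondwise logarithm of a periodic configuration is a periodic direction field. [folklore] -/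
theorem isPeriodicDir_mlog_cfg {V : Site d → Fin d → (Matrix n n ℂ)ˣ} {P : ℤ} (hV : IsPeriodicCfg V P) :
    IsPeriodicDir (fun y μ => mlog ((V y μ : (Matrix n n ℂ)ˣ) : (Matrix n n ℂ))) P := fun x κ μ => by
  show mlog ((V (x + P • e κ) μ : (Matrix n n ℂ)ˣ) : (Matrix n n ℂ)) = mlog ((V x μ : (Matrix n n ℂ)ˣ) : (Matrix n n ℂ))
  rw [hV x κ μ]

/-- The bondwise logarithm of a unitary configuration within `1∕4` of `1` is a skew direction field. [folklore] -/
theorem isSkewDir_mlog_cfg {V : Site d → Fin d → (Matrix n n ℂ)ˣ} (hV : IsUnitaryCfg V) (h : ∀ (y : Site d) (μ : Fin d), ‖((V y μ : (Matrix n n ℂ)ˣ) : (Matrix n n ℂ)) - 1‖ ≤ 1 / 4) :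
    IsSkewDir (fun y μ => mlog ((V y μ : (Matrix n n ℂ)ˣ) : (Matrix n n ℂ))) := fun y μ => mlog_mem_skewAdjoint_of_unitary (hV y μ) (h y μ)

/-- `Δ_1 λ` of a skew site field is skew (`Δ_1 = covDiv_1 ∘ D_1`). [folklore] -/
theorem covLapSite_flatCfg_skew {lam : Site d → (Matrix n n ℂ)} (hlam : ∀ y, lam y ∈ skewAdjoint (Matrix n n ℂ)) (y : Site d) :
    covLapSite (flatCfg (d := d) (n := n)) lam y ∈ skewAdjoint (Matrix n n ℂ) := by
  rw [← congrFun (covDiv_gaugeDir_eq_covLapSite (flatCfg (d := d) (n := n)) lam) y]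
  exact covDiv_mem_skewAdjoint isUnitaryCfg_flatCfg (gaugeDir_skew isUnitaryCfg_flatCfg hlam) y

/-- The backward flat divergence of a periodic direction field is periodic. [folklore] -/
theorem covDiv_flatCfg_add_period {P : ℕ} {Y : Site d → Fin d → (Matrix n n ℂ)} (hY : IsPeriodicDir Y (P : ℤ)) (x : Site d) (τ : Fin d) :
    covDiv (flatCfg (d := d) (n := n)) Y (x + (P : ℤ) • e τ) = covDiv (flatCfg (d := d) (n := n)) Y x :=
  covDiv_add_period (isPeriodicCfg_flatCfg _) hY x τ

/-! ## §2 One Newton step -/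

/-- **ONE NEWTON STEP OF THE FLAT LANDAU SCHEME** (every `d ≥ 1`, `L ≥ 2`, `N ≥ 1`, level `j+1`, `M = L^{j+1}`, period `P = N·M`; the flat sup letters
(H0) `hG` and (HR) `hR` as hypotheses with constants `c₀, c₁, c_R`).  STATE `(u, λ)`: `u` unitary periodic, `V := U^{u}` with `‖V(b) − 1‖ ≤ r ≤ 1∕20` and
`‖covDiv 1 (log V)(x)‖ ≤ b`, `λ ∈ N(Q′(1))` with `log V + D_1λ` (1.38)-Landau and `‖Δ_1λ(y)‖ ≤ D`, in the regime `c₀M²D ≤ 1∕10`, `c₁MD ≤ 1∕25`.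
STEP: `u′ = e^{λ}·u` and ANY `λ′ ∈ N(Q′(1))` with `log U^{u′} + D_1λ′` (1.38)-Landau.  THEN: `u′` unitary periodic, `‖U^{u′}(b) − 1‖ ≤ r + (5∕4)c₁MD`,
`‖covDiv 1 (log U^{u′})(x)‖ ≤ b + D + D·Θ`, **`‖Δ_1λ′(y)‖ ≤ c_R·(D·Θ)`**, `‖u′(y) − u(y)‖ ≤ 2c₀M²D`, with
`Θ = 4c₀M²(b + D) + 25·d·r·(c₁M) + 14·d·(c₁M)²·D`.  (The contraction: `c_R·Θ ≤ 1∕2` makes the defect halve.) [folklore] -/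
theorem newton_step [Nonempty n] (hd : 1 ≤ d) {L N : ℕ} (hL : 2 ≤ L) (hN : 1 ≤ N) (j : ℕ) {c₀ c₁ cR : ℝ}
    (hG : ∀ mu ∈ avgKernelGauges (d := d) (n := n) L N (j + 1) (flatCfg (d := d) (n := n)), ∀ B : ℝ,
      (∀ y : Site d, ‖covLapSite (flatCfg (d := d) (n := n)) mu y‖ ≤ B) →
        (∀ y : Site d, ‖mu y‖ ≤ c₀ * ((L : ℝ) ^ (j + 1)) ^ 2 * B) ∧
        (∀ (y : Site d) (μ : Fin d), ‖gaugeDir (flatCfg (d := d) (n := n)) mu y μ‖ ≤ c₁ * (L : ℝ) ^ (j + 1) * B))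
    (hR : ∀ (F : Site d → (Matrix n n ℂ)), (∀ y : Site d, F y ∈ skewAdjoint (Matrix n n ℂ)) →
      (∀ (y : Site d) (i : Fin d), F (y + ((N * L ^ (j + 1) : ℕ) : ℤ) • e i) = F y) →
      ∀ mu ∈ avgKernelGauges (d := d) (n := n) L N (j + 1) (flatCfg (d := d) (n := n)),
        (∀ nu ∈ avgKernelGauges (d := d) (n := n) L N (j + 1) (flatCfg (d := d) (n := n)),
          ∑ y ∈ periodBox (d := d) (N * L ^ (j + 1)),
            hsR (F y + covLapSite (flatCfg (d := d) (n := n)) mu y) (covLapSite (flatCfg (d := d) (n := n)) nu y) = 0) →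
        ∀ B : ℝ, (∀ y : Site d, ‖F y‖ ≤ B) → ∀ y : Site d, ‖covLapSite (flatCfg (d := d) (n := n)) mu y‖ ≤ cR * B)
    {U : Site d → Fin d → (Matrix n n ℂ)ˣ} (hUu : IsUnitaryCfg U) (hUP : IsPeriodicCfg U ((N * L ^ (j + 1) : ℕ) : ℤ))
    {u : Site d → (Matrix n n ℂ)ˣ} (huU : IsUnitarySite u) (huP : IsPeriodicSite u ((N * L ^ (j + 1) : ℕ) : ℤ))
    {r b D : ℝ} (hr : ∀ (y : Site d) (μ : Fin d), ‖((gaugeAct u U y μ : (Matrix n n ℂ)ˣ) : (Matrix n n ℂ)) - 1‖ ≤ r) (hr1 : r ≤ 1 / 20)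
    (hb : ∀ x : Site d, ‖covDiv (flatCfg (d := d) (n := n)) (fun y μ => mlog ((gaugeAct u U y μ : (Matrix n n ℂ)ˣ) : (Matrix n n ℂ))) x‖ ≤ b)
    {lam : Site d → (Matrix n n ℂ)} (hlam : lam ∈ avgKernelGauges (d := d) (n := n) L N (j + 1) (flatCfg (d := d) (n := n)))
    (hLan : IsLandauB8 (d := d) L N (j + 1) (flatCfg (d := d) (n := n))
      (fun y κ => mlog ((gaugeAct u U y κ : (Matrix n n ℂ)ˣ) : (Matrix n n ℂ)) + gaugeDir (flatCfg (d := d) (n := n)) lam y κ))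
    (hD : ∀ y : Site d, ‖covLapSite (flatCfg (d := d) (n := n)) lam y‖ ≤ D)
    (hΛ1 : c₀ * ((L : ℝ) ^ (j + 1)) ^ 2 * D ≤ 1 / 10) (hγ1 : c₁ * (L : ℝ) ^ (j + 1) * D ≤ 1 / 25)
    {u' : Site d → (Matrix n n ℂ)ˣ} (hu' : u' = fun y => expUnit (lam y) * u y)
    {lam' : Site d → (Matrix n n ℂ)} (hlam' : lam' ∈ avgKernelGauges (d := d) (n := n) L N (j + 1) (flatCfg (d := d) (n := n)))
    (hLan' : IsLandauB8 (d := d) L N (j + 1) (flatCfg (d := d) (n := n))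
      (fun y κ => mlog ((gaugeAct u' U y κ : (Matrix n n ℂ)ˣ) : (Matrix n n ℂ)) + gaugeDir (flatCfg (d := d) (n := n)) lam' y κ)) :
    IsUnitarySite u' ∧ IsPeriodicSite u' ((N * L ^ (j + 1) : ℕ) : ℤ) ∧
    (∀ (y : Site d) (μ : Fin d), ‖((gaugeAct u' U y μ : (Matrix n n ℂ)ˣ) : (Matrix n n ℂ)) - 1‖ ≤ r + 5 / 4 * (c₁ * (L : ℝ) ^ (j + 1) * D)) ∧
    (∀ x : Site d, ‖covDiv (flatCfg (d := d) (n := n)) (fun y μ => mlog ((gaugeAct u' U y μ : (Matrix n n ℂ)ˣ) : (Matrix n n ℂ))) x‖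
      ≤ b + D + D * (4 * (c₀ * ((L : ℝ) ^ (j + 1)) ^ 2) * (b + D) + 25 * d * r * (c₁ * (L : ℝ) ^ (j + 1))
        + 14 * d * (c₁ * (L : ℝ) ^ (j + 1)) ^ 2 * D)) ∧
    (∀ y : Site d, ‖covLapSite (flatCfg (d := d) (n := n)) lam' y‖
      ≤ cR * (D * (4 * (c₀ * ((L : ℝ) ^ (j + 1)) ^ 2) * (b + D) + 25 * d * r * (c₁ * (L : ℝ) ^ (j + 1))
        + 14 * d * (c₁ * (L : ℝ) ^ (j + 1)) ^ 2 * D))) ∧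
    (∀ y : Site d, ‖(u' y : (Matrix n n ℂ)) - u y‖ ≤ 2 * (c₀ * ((L : ℝ) ^ (j + 1)) ^ 2 * D)) := by
  subst hu'
  set M : ℝ := (L : ℝ) ^ (j + 1) with hM
  have hL1 : 1 ≤ L := by omega
  have hP : 1 ≤ N * L ^ (j + 1) := Nat.mul_pos (by omega) (Nat.pow_pos (by omega))
  set Λ : ℝ := c₀ * M ^ 2 * D with hΛ_def
  set γ : ℝ := c₁ * M * D with hγ_def
  -- the current field and its letters
  set V : Site d → Fin d → (Matrix n n ℂ)ˣ := gaugeAct u U with hV_def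
  have hVu : IsUnitaryCfg V := AveragingDeficitKDatum.isUnitaryCfg_gaugeAct huU hUu
  have hVP : IsPeriodicCfg V ((N * L ^ (j + 1) : ℕ) : ℤ) := NE3ResidualSliceRep.isPeriodicCfg_gaugeAct huP hUP
  have hZP : IsPeriodicDir (fun y μ => mlog ((V y μ : (Matrix n n ℂ)ˣ) : (Matrix n n ℂ))) ((N * L ^ (j + 1) : ℕ) : ℤ) := isPeriodicDir_mlog_cfg hVP
  have hZs : IsSkewDir (fun y μ => mlog ((V y μ : (Matrix n n ℂ)ˣ) : (Matrix n n ℂ))) := isSkewDir_mlog_cfg hVu fun y μ => (hr y μ).trans (by linarith)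
  -- the generator: skew, periodic; (H0)
  have hlams : ∀ y, lam y ∈ skewAdjoint (Matrix n n ℂ) := hlam.1
  have hlamP : ∀ (y : Site d) (i : Fin d), lam (y + ((N * L ^ (j + 1) : ℕ) : ℤ) • e i) = lam y := hlam.2.1
  obtain ⟨hΛ, hγ0⟩ := hG lam hlam D hD
  have hγ : ∀ (y : Site d) (μ : Fin d), ‖lam (y + e μ) - lam y‖ ≤ γ := fun y μ => by
    have h := hγ0 y μ
    rwa [gaugeDir_flatCfg_eq_neg_dPot, norm_neg, dPot] at h
  have hΛle : Λ ≤ 1 / 10 := hΛ1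
  have hγle : γ ≤ 1 / 25 := hγ1
  have hd' : 0 < d := hd
  have hΛ0 : 0 ≤ Λ := (norm_nonneg _).trans (hΛ 0)
  have hγ0' : 0 ≤ γ := (norm_nonneg _).trans (hγ 0 ⟨0, hd'⟩)
  have hr0 : 0 ≤ r := (norm_nonneg _).trans (hr 0 ⟨0, hd'⟩)
  have hD0 : 0 ≤ D := (norm_nonneg _).trans (hD 0)
  have hb0 : 0 ≤ b := (norm_nonneg _).trans (hb 0)
  -- the new gauge `u′ = e^{λ}·u`, unitary periodic, and `U^{u′} = V^{e^λ}`
  set w : Site d → (Matrix n n ℂ)ˣ := fun y => expUnit (lam y) with hw_def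
  have hw : ∀ y, (w y : (Matrix n n ℂ)) = exp (lam y) := fun y => rfl
  have hwU : IsUnitarySite w := expGauge_unitary hlams hw
  have hwP : IsPeriodicSite w ((N * L ^ (j + 1) : ℕ) : ℤ) := fun y i => by simp only [hw_def, hlamP y i]
  have hprod : (fun y => expUnit (lam y) * u y) = w * u := rfl
  have hact : gaugeAct (fun y => expUnit (lam y) * u y) U = gaugeAct w V := by
    rw [hprod, B8Eq115GaugeFixing.gaugeAct_mul]
  have hu'U : IsUnitarySite (fun y => expUnit (lam y) * u y) := fun y => (unitaryUnits (Matrix n n ℂ)).mul_mem (hwU y) (huU y)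
  have hu'P : IsPeriodicSite (fun y => expUnit (lam y) * u y) ((N * L ^ (j + 1) : ℕ) : ℤ) := fun y i => by
    show expUnit (lam (y + ((N * L ^ (j + 1) : ℕ) : ℤ) • e i)) * u (y + ((N * L ^ (j + 1) : ℕ) : ℤ) • e i) = expUnit (lam y) * u y
    rw [hlamP y i, huP y i]
  -- letter 2b: the new radius and the junk
  have hlet : ∀ (y : Site d) (μ : Fin d), ‖((gaugeAct w V y μ : (Matrix n n ℂ)ˣ) : (Matrix n n ℂ)) - 1‖ ≤ r + 5 / 4 * γ ∧
      ‖mlog ((gaugeAct w V y μ : (Matrix n n ℂ)ˣ) : (Matrix n n ℂ))‖ ≤ 2 * (r + 5 / 4 * γ) ∧ mlog ((gaugeAct w V y μ : (Matrix n n ℂ)ˣ) : (Matrix n n ℂ)) ∈ skewAdjoint (Matrix n n ℂ) ∧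
      gaugeAct w V y μ ∈ unitaryUnits (Matrix n n ℂ) := fun y μ =>
    gaugeAct_letters hVu hr hr1 hlams hΛ hΛle hγ hγle hw y μ
  have hJ : ∀ x : Site d, ‖covDiv flatCfg (fun y μ => mlog ((gaugeAct w V y μ : (Matrix n n ℂ)ˣ) : (Matrix n n ℂ))) x
      - covDiv flatCfg (fun y μ => mlog ((V y μ : (Matrix n n ℂ)ˣ) : (Matrix n n ℂ))) x - covLapSite flatCfg lam x‖
      ≤ D * (4 * (c₀ * M ^ 2) * (b + D) + 25 * d * r * (c₁ * M) + 14 * d * (c₁ * M) ^ 2 * D) := by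
    intro x
    have h := norm_covDiv_mlog_gaugeAct_sub_le hVu hr hr1 hlams hΛ hΛle hγ hγle hw x
    have h2 : 4 * Λ * (‖covDiv flatCfg (fun y μ => mlog ((V y μ : (Matrix n n ℂ)ˣ) : (Matrix n n ℂ))) x‖ + ‖covLapSite flatCfg lam x‖) + 25 * d * r * γ + 14 * d * γ ^ 2
        ≤ 4 * Λ * (b + D) + 25 * d * r * γ + 14 * d * γ ^ 2 := by
      gcongr
      · exact hb x
      · exact hD x
    refine (h.trans h2).trans (le_of_eq ?_)
    simp only [hΛ_def, hγ_def]; ring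
  -- the new potential: periodic, skew
  have hV'P : IsPeriodicCfg (gaugeAct w V) ((N * L ^ (j + 1) : ℕ) : ℤ) := NE3ResidualSliceRep.isPeriodicCfg_gaugeAct hwP hVP
  have hZ'P : IsPeriodicDir (fun y μ => mlog ((gaugeAct w V y μ : (Matrix n n ℂ)ˣ) : (Matrix n n ℂ))) ((N * L ^ (j + 1) : ℕ) : ℤ) := isPeriodicDir_mlog_cfg hV'P
  have hZ's : IsSkewDir (fun y μ => mlog ((gaugeAct w V y μ : (Matrix n n ℂ)ˣ) : (Matrix n n ℂ))) := fun y μ => (hlet y μ).2.2.1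
  -- (HR) on the junk `J`: the next Landau defect
  have hlam's : ∀ y, lam' y ∈ skewAdjoint (Matrix n n ℂ) := hlam'.1
  have hlam'P : ∀ (y : Site d) (i : Fin d), lam' (y + ((N * L ^ (j + 1) : ℕ) : ℤ) • e i) = lam' y := hlam'.2.1
  rw [hact] at hLan'
  set J : Site d → (Matrix n n ℂ) := fun x => covDiv flatCfg (fun y μ => mlog ((gaugeAct w V y μ : (Matrix n n ℂ)ˣ) : (Matrix n n ℂ))) x
      - covDiv flatCfg (fun y μ => mlog ((V y μ : (Matrix n n ℂ)ˣ) : (Matrix n n ℂ))) x - covLapSite flatCfg lam x with hJ_def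
  have hJs : ∀ y, J y ∈ skewAdjoint (Matrix n n ℂ) := fun y =>
    (skewAdjoint (Matrix n n ℂ)).sub_mem ((skewAdjoint (Matrix n n ℂ)).sub_mem (covDiv_mem_skewAdjoint isUnitaryCfg_flatCfg hZ's y)
      (covDiv_mem_skewAdjoint isUnitaryCfg_flatCfg hZs y)) (covLapSite_flatCfg_skew hlams y)
  have hJP : ∀ (y : Site d) (i : Fin d), J (y + ((N * L ^ (j + 1) : ℕ) : ℤ) • e i) = J y := fun y i => by
    simp only [hJ_def, covDiv_flatCfg_add_period hZ'P, covDiv_flatCfg_add_period hZP,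
      covLapSite_add_period (isPeriodicCfg_flatCfg _) hlamP]
  have horth : ∀ nu ∈ avgKernelGauges (d := d) (n := n) L N (j + 1) (flatCfg (d := d) (n := n)),
      ∑ y ∈ periodBox (d := d) (N * L ^ (j + 1)), hsR (J y + covLapSite flatCfg lam' y) (covLapSite flatCfg nu y) = 0 := by
    intro nu hnu
    have E1 := sum_hsR_covDiv_add_covLapSite_eq_zero_of_isLandauB8 hP isUnitaryCfg_flatCfg (isPeriodicCfg_flatCfg _) hZ'P hlam'P hLan' hnu
    have E0 := sum_hsR_covDiv_add_covLapSite_eq_zero_of_isLandauB8 hP isUnitaryCfg_flatCfg (isPeriodicCfg_flatCfg _) hZP hlamP hLan hnu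
    have hpt : ∀ y : Site d, J y + covLapSite flatCfg lam' y
        = (covDiv flatCfg (fun y μ => mlog ((gaugeAct w V y μ : (Matrix n n ℂ)ˣ) : (Matrix n n ℂ))) y + covLapSite flatCfg lam' y)
          - (covDiv flatCfg (fun y μ => mlog ((V y μ : (Matrix n n ℂ)ˣ) : (Matrix n n ℂ))) y + covLapSite flatCfg lam y) := fun y => by
      simp only [hJ_def]; abel
    simp_rw [hpt, hsR_sub_left, Finset.sum_sub_distrib, E1, E0, sub_zero]
  have hD' : ∀ y : Site d, ‖covLapSite flatCfg lam' y‖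
      ≤ cR * (D * (4 * (c₀ * M ^ 2) * (b + D) + 25 * d * r * (c₁ * M) + 14 * d * (c₁ * M) ^ 2 * D)) :=
    hR J hJs hJP lam' hlam' horth _ hJ
  -- the remaining conclusions
  refine ⟨hu'U, hu'P, ?_, ?_, hD', ?_⟩
  · intro y μ
    rw [hact]
    exact (hlet y μ).1
  · intro x
    rw [hact]
    have hid : covDiv flatCfg (fun y μ => mlog ((gaugeAct w V y μ : (Matrix n n ℂ)ˣ) : (Matrix n n ℂ))) x
        = covDiv flatCfg (fun y μ => mlog ((V y μ : (Matrix n n ℂ)ˣ) : (Matrix n n ℂ))) x + covLapSite flatCfg lam x + J x := by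
      simp only [hJ_def]; abel
    rw [hid]
    calc _ ≤ ‖covDiv flatCfg (fun y μ => mlog ((V y μ : (Matrix n n ℂ)ˣ) : (Matrix n n ℂ))) x‖ + ‖covLapSite flatCfg lam x‖ + ‖J x‖ := norm_add₃_le
      _ ≤ b + D + D * (4 * (c₀ * M ^ 2) * (b + D) + 25 * d * r * (c₁ * M) + 14 * d * (c₁ * M) ^ 2 * D) :=
          add_le_add (add_le_add (hb x) (hD x)) (hJ x)
  · intro y
    have h1 : ((expUnit (lam y) * u y : (Matrix n n ℂ)ˣ) : (Matrix n n ℂ)) - u y = (exp (lam y) - 1) * (u y : (Matrix n n ℂ)) := by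
      rw [Units.val_mul, val_expUnit, sub_mul, one_mul]
    have hu1 : ‖(u y : (Matrix n n ℂ))‖ = 1 := CStarRing.norm_of_mem_unitary (mem_unitaryUnits.mp (huU y))
    rw [h1]
    calc _ ≤ ‖exp (lam y) - 1‖ * ‖(u y : (Matrix n n ℂ))‖ := norm_mul_le _ _
      _ ≤ 2 * Λ * 1 := by
          rw [hu1]
          exact mul_le_mul_of_nonneg_right ((hw y) ▸ norm_expGauge_sub_one_le hw hΛ (by linarith) y) zero_le_one
      _ = 2 * (c₀ * M ^ 2 * D) := by rw [hΛ_def]; ring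

end

end Summit.QuantumFields.BalabanUV.T4Continuum.NE3.FlatLandauNewtonStep
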